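import Summits.BirchSwinnertonDyer.BirchSwinnertonDyer.Theorems.QuadraticBranchSignedControlPlusEtaNonsurjCartanFieldCMAnchor
import Summits.BirchSwinnertonDyer.Rank1Residual.GaloisImage.SupersingularNonsplitCartanNormalizer
import Literature.NumberTheory.EllipticCurves.SerreOpenImageSupersingularFrobeniusProofs
import HarnessLib

/-!
# Route `QuadraticBranchSignedControl` (rung K8, cell `bsd-potss`): crux stmt-BirchSwinnertonDyer-19606
# `PlusEtaMainConjectureNonsurj` — THE CARTAN FIELD OF A ROW IS UNRAMIFIED AT `p` AND OUTSIDE THE ADDITIVE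
# PRIMES, AND `p` IS INERT IN IT (kernel form of FINDING-19606-k8eta-c2-g5 §2 (b), first half)

WHAT. Continuation of `…PlusEtaNonsurjCartanField` / `…CartanFieldCMAnchor` (k8eta-c2 g9): on a row of crux 19606
(`V/ℚ` globally minimal, `p ≥ 5` good with `a_p = 0`, `p`-adic tower NOT onto) the CARTAN SUBGROUP `H_V ≤ Γ_ℚ` —
frame-free: the `σ` centralising every square `τ²` on `V[p]`; `= ρ̄⁻¹(C_ns(p))`, index `2`, fixed field the Cartan
field `K_V` — was shown to be intrinsic, a mod-`p` invariant, to exclude complex conjugation (`K_V` imaginary) and to be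
`Γ_K` for the CM field `K` of any CM anchor. This file adds the LOCAL structure of `K_V`, by bridging `H_V` to the
residual cell's index-`2` subgroup `U = ρ̄⁻¹(Φ⁻¹(kˣ))` of `GaloisImage.exists_index_two_subgroup_of_goodSS_of_not_surj`
(`kˣ` = the inertia non-split Cartan subgroup at `p`, Serre 1972 Prop. 12 c)) and to the tree's Prop. 12 d)
(`galoisRepTorsion_not_mem_map_inertia_of_isArithFrobAt`: at a good supersingular prime a Frobenius does NOT act through
the inertia image):

* §1 **bridge** `centralizes_sq_of_apply_mem_unitGroup`: in any `GL₂(𝔽_p)`-frame `(e, Φ)` with `Φ(ρ̄(Γ_ℚ)) ≤ N(kˣ)`,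
  `Φ(ρ̄ σ) ∈ kˣ ⟹ σ ∈ H_V` (squares of `N(kˣ)` lie in the commutative `kˣ`); `apply_mem_unitGroup_iff_centralizes_sq`:
  on a row (`GoodSS`, `¬Surj`, `p ≠ 2`) **`U = H_V`** (both have index `2`).
* §2 **`K_V` is unramified at `p` and at every good or multiplicative place** `inertia_centralizes_sq_of_row`: for a
  place `v` of `ℚ` with `v = p`, or `V` good at `v`, or `V` multiplicative at `v`, every element of the inertia group
  of every prime `𝔔 ∣ v` of `ℤ̄` centralises the squares on `V[p]` (`I_𝔔 ≤ H_V`). So `K_V` ramifies only at ADDITIVE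
  primes of `V` (g5's `K_V = ℚ(√−(8t² − 12t + 7))` on `X_ns⁺(5)`: the discriminant is supported on the additive primes).
* §3 **`p` is INERT in `K_V`** `exists_frob_not_centralizes_sq_of_row`: above `p` there are a prime `𝔓` of `ℤ̄` and a
  `φ` in its decomposition group `D_𝔓 = Stab(𝔓)` which does NOT centralise the squares (`φ ∉ H_V`) — with §2
  (`I_𝔓 ≤ H_V`) the residue degree of `K_V` at `p` is `2`; `forall_exists_frob_not_centralizes_sq_of_row`: the same above
  EVERY prime `𝔓 ∣ p` (conjugation; `H_V` is normal). Packaged: `cartanSubgroup_local_of_row`.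
* §4 **consequence for CM anchors** (`…CartanFieldCMAnchor`: an anchor `A` with a `√D`-structure `(Ψ ≠ 0, χ ≠ 1)` has
  `H_V = ker χ`): `chi_eq_one_of_mem_inertia_of_cmAnchor_of_row` — `χ` kills the inertia at `p` and at the good and
  multiplicative places of `V` (the CM field `K = ℚ̄^{ker χ}` is unramified there); `exists_frob_chi_ne_one_of_cmAnchor_of_row`
  — some `φ ∈ D_𝔓`, `𝔓 ∣ p`, has `χ(φ) ≠ 1`: **`p` is inert in the CM field of every CM anchor of a row**. At `p = 5`
  this is g5's list BY STRUCTURE: a CM anchor needs an imaginary quadratic `K` of class number one with `5` inert,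
  `K ∈ {ℚ(√−2), ℚ(√−3), ℚ(√−7), ℚ(√−43), ℚ(√−67), ℚ(√−163)}` (`5` splits in `ℚ(√−1)`, `ℚ(√−11)`, `ℚ(√−19)`), whose
  discriminant divides a power of the additive conductor of `V`.

HONEST FRAMING (cell `bsd-potss`, run/shared/lean/pub/bsd-potss/; FULL-BSD rank ≤ 1 programme): TOOL THEOREMS ONLY
(no definition, no named fact, no `sorry`, axioms standard); the CM input of §4 is DISPLAYED as the hypothesis `(Ψ, χ)`
exactly as in `…CartanFieldCMAnchor`. Nothing is booked; crux 19606 stays OPEN; `BSD(W, p)` is claimed for no pair.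
Seat `bsd-potss-k8eta-c2` g10 (prover), `--supports stmt-BirchSwinnertonDyer-19606`.

References: [Serre1972] §1.11 Prop. 12 c), d) (p. 275), §2.2 Prop. 14, §4.2 c), §5.4; [Zywina2015] Thm. 1.4;
S. Frengley, arXiv:2111.05813, Lemma 28 (the Cartan field of `X_ns⁺(5)`); [Lang1987] Ch. 10 §4.
-/

set_option autoImplicit false
set_option linter.dupNamespace false

noncomputable section

open scoped Classical NumberField Pointwise

open Matrix Field IsDedekindDomain NumberField WeierstrassCurve Literature.NumberTheory.EllipticCurves
  Literature.NumberTheory.GaloisRepresentations Literature.NumberTheory.GaloisRepresentations.Serre1972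
  Literature.NumberTheory.SerreUniformity Literature.NumberTheory.EllipticCurves.Rank1Residual Rat.HeightOneSpectrum
open Summit.BirchSwinnertonDyer.Rank1Residual.O6 (ModPCongruent)
open Summit.BirchSwinnertonDyer.Rank1Residual.GaloisImage

namespace Summit.BirchSwinnertonDyer.BirchSwinnertonDyer.Theorems.EtaCartanField

/-! ## §1 Bridge: the residual cell's `U = ρ̄⁻¹(Φ⁻¹(kˣ))` is the Cartan subgroup `H_V` -/

section Frame

variable (W : WeierstrassCurve ℚ) [W.IsElliptic] (p : ℕ) [hp : Fact p.Prime]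
  (Φ : Multiplicative (AddAut (geomTorsion W p)) ≃* GL (Fin 2) (ZMod p))
  (e : geomTorsion W p ≃+ (Fin 2 → ZMod p))
  (he : ∀ (g : Multiplicative (AddAut (geomTorsion W p))) (x : geomTorsion W p),
    e (Multiplicative.toAdd g x) =
      ((Φ g : GL (Fin 2) (ZMod p)) : Matrix (Fin 2) (Fin 2) (ZMod p)) *ᵥ e x)

omit [W.IsElliptic] in
include he in
/-- In a `GL₂(𝔽_p)`-frame `(e, Φ)` of `E[p]`, `σ ∈ Γ_ℚ` acts on coordinates through the matrix `Φ(ρ̄ σ)`. [folklore] -/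
theorem frame_smul (σ : absoluteGaloisGroup ℚ) (P : geomTorsion W p) :
    e (σ • P) = ((Φ (galoisRepTorsion W p σ) : GL (Fin 2) (ZMod p)) : Matrix (Fin 2) (Fin 2) (ZMod p)) *ᵥ e P := by
  rw [← galoisRepTorsion_apply W p σ P]
  exact he (galoisRepTorsion W p σ) P

omit [W.IsElliptic] in
include he in
/-- **Bridge, first half.** If the image `Φ(ρ̄(Γ_ℚ))` normalises the non-split Cartan subgroup `kˣ` (`k ⊆ M₂(𝔽_p)` a
field of degree `2`, `p ≠ 2`) and `Φ(ρ̄ σ) ∈ kˣ`, then `σ` centralises every square `τ²` on `E[p]`: `(N(kˣ) : kˣ) = 2`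
puts `Φ(ρ̄ τ)² ∈ kˣ`, and `kˣ` is commutative. So the residual cell's `U = ρ̄⁻¹(Φ⁻¹(kˣ))` lies inside the Cartan
subgroup `H_V` of `…PlusEtaNonsurjCartanField`. [cite: Serre1972, §2.2] -/
theorem centralizes_sq_of_apply_mem_unitGroup (hp2 : p ≠ 2)
    {k : Subalgebra (ZMod p) (Matrix (Fin 2) (Fin 2) (ZMod p))} (hk : IsField k)
    (h2 : Module.finrank (ZMod p) k = 2)
    (hGN : (galoisRepTorsion W p).range.map Φ.toMonoidHom ≤
      Subgroup.normalizer (unitGroup k : Set (GL (Fin 2) (ZMod p))))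
    {σ : absoluteGaloisGroup ℚ} (hσ : Φ (galoisRepTorsion W p σ) ∈ unitGroup k) :
    ∀ (τ : absoluteGaloisGroup ℚ) (P : geomTorsion W p), σ • ((τ * τ) • P) = (τ * τ) • (σ • P) := by
  intro τ P
  set N : Subgroup (GL (Fin 2) (ZMod p)) := Subgroup.normalizer (unitGroup k : Set (GL (Fin 2) (ZMod p)))
    with hN
  have hC : unitGroup k ∈ cartanSubgroups (ZMod p) := unitGroup_mem_cartanSubgroups hk h2
  have hidx : ((unitGroup k).subgroupOf N).index = 2 := relIndex_normalizer_eq_two hC (fun _ ↦ hp2)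
  -- `Φ(ρ̄ τ) ∈ N(kˣ)`, so its square lies in `kˣ`
  have hτN : Φ (galoisRepTorsion W p τ) ∈ N := hGN (apply_galoisRepTorsion_mem_map_range W p Φ τ)
  have hττ : Φ (galoisRepTorsion W p (τ * τ)) ∈ unitGroup k := by
    have hsq := Subgroup.mul_self_mem_of_index_two hidx ⟨Φ (galoisRepTorsion W p τ), hτN⟩
    rw [Subgroup.mem_subgroupOf] at hsq
    rw [map_mul, map_mul]
    exact hsq
  -- the two matrices commute (`k` is a field)
  set Mσ : Matrix (Fin 2) (Fin 2) (ZMod p) :=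
    ((Φ (galoisRepTorsion W p σ) : GL (Fin 2) (ZMod p)) : Matrix (Fin 2) (Fin 2) (ZMod p)) with hMσ
  set Mτ : Matrix (Fin 2) (Fin 2) (ZMod p) :=
    ((Φ (galoisRepTorsion W p (τ * τ)) : GL (Fin 2) (ZMod p)) : Matrix (Fin 2) (Fin 2) (ZMod p)) with hMτ
  have hMσk : Mσ ∈ k := mem_unitGroup_iff.mp hσ
  have hMτk : Mτ ∈ k := mem_unitGroup_iff.mp hττ
  have hcomm : Mσ * Mτ = Mτ * Mσ := by
    have h := hk.mul_comm ⟨Mσ, hMσk⟩ ⟨Mτ, hMτk⟩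
    exact congrArg Subtype.val h
  apply e.injective
  rw [frame_smul W p Φ e he σ, frame_smul W p Φ e he (τ * τ), frame_smul W p Φ e he (τ * τ),
    frame_smul W p Φ e he σ, Matrix.mulVec_mulVec, Matrix.mulVec_mulVec, ← hMσ, ← hMτ, hcomm]

include he in
/-- **Bridge: `U = H_V`.** At a good supersingular `p ≠ 2` with `ρ̄_{E,p}` not onto (`E = W/ℚ` globally minimal), for
ANY field `k ⊆ M₂(𝔽_p)` of degree `2` with `kˣ ⊴ Φ(ρ̄(Γ_ℚ)) ≤ N(kˣ)`-shape (`G ≤ N(kˣ)`, `G ⊄ kˣ`):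
`Φ(ρ̄ σ) ∈ kˣ ⟺ σ` centralises the squares on `E[p]`. (`U ≤ H_V` by `centralizes_sq_of_apply_mem_unitGroup`; both
have index `2` — `index_comap_cartan_eq_two` and `exists_subgroup_index_two_centralizes_sq` on the EXACT image
`C_ns⁺(p)` of `hasModPImageEqNonsplitCartanNormalizer_of_goodSS_of_not_surj` — hence equal.) [cite: Serre1972, §2.2, §4.2 c)] -/
theorem apply_mem_unitGroup_iff_centralizes_sq [W.IsGloballyMinimal] (hp2 : p ≠ 2) (hss : GoodSS W p)
    (hns : ¬ Surj W p) {k : Subalgebra (ZMod p) (Matrix (Fin 2) (Fin 2) (ZMod p))} (hk : IsField k)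
    (h2 : Module.finrank (ZMod p) k = 2)
    (hGN : (galoisRepTorsion W p).range.map Φ.toMonoidHom ≤
      Subgroup.normalizer (unitGroup k : Set (GL (Fin 2) (ZMod p))))
    (hGC : ¬ (galoisRepTorsion W p).range.map Φ.toMonoidHom ≤ unitGroup k) (σ : absoluteGaloisGroup ℚ) :
    Φ (galoisRepTorsion W p σ) ∈ unitGroup k ↔
      ∀ (τ : absoluteGaloisGroup ℚ) (P : geomTorsion W p), σ • ((τ * τ) • P) = (τ * τ) • (σ • P) := by
  set U : Subgroup (absoluteGaloisGroup ℚ) := ((unitGroup k).comap Φ.toMonoidHom).comap (galoisRepTorsion W p)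
    with hU
  have hC : unitGroup k ∈ cartanSubgroups (ZMod p) := unitGroup_mem_cartanSubgroups hk h2
  have hCp : (∃ P : GL (Fin 2) (ZMod p), unitGroup k = splitCartan P) → p ≠ 2 := fun _ ↦ hp2
  have hU2 : U.index = 2 := index_comap_cartan_eq_two W p Φ hC hCp hGN hGC
  obtain ⟨H, hH2, hHmem⟩ := exists_subgroup_index_two_centralizes_sq hp2
    (hasModPImageEqNonsplitCartanNormalizer_of_goodSS_of_not_surj W p hp2 hss hns)
  have hUH : U ≤ H := fun ν hν ↦
    (hHmem ν).mpr (centralizes_sq_of_apply_mem_unitGroup W p Φ e he hp2 hk h2 hGN ((mem_comap_cartan_iff W p Φ).mp hν))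
  have hHU : H ≤ U := by
    have hmul := Subgroup.relIndex_mul_index hUH
    rw [hH2, hU2] at hmul
    have h1 : U.relIndex H = 1 := by omega
    exact Subgroup.relIndex_eq_one.mp h1
  have hUeq : U = H := le_antisymm hUH hHU
  rw [← mem_comap_cartan_iff W p Φ, ← hU, hUeq]
  exact hHmem σ

end Frame

/-! ## §2 `K_V` is unramified at `p` and at the good and multiplicative places -/

section Row

variable (V : WeierstrassCurve ℚ) [V.IsElliptic] [V.IsGloballyMinimal] (p : ℕ) [hp : Fact p.Prime]

/-- Row hypotheses ⟹ the residual cell's `GoodSS V p ∧ ¬ Surj V p` (`a_p = 0`; a tower that is not onto is not onto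
mod `p` at `p ≥ 5`, `serre_hasSurjectiveModNGaloisRep_pow_holds`). [cite: Serre1972, §1.11 Prop. 12]
[cite: SerreAbelianLadic1968, Ch. IV §3.4 Lemma 3] -/
theorem goodSS_and_not_surj_of_row (hp5 : 5 ≤ p) (hgood : V.HasGoodReductionAtPrime p)
    (hap : V.frobeniusTrace p = 0) (hns : ¬ ∀ m : ℕ, V.HasSurjectiveModNGaloisRep (p ^ m : ℕ)) :
    GoodSS V p ∧ ¬ Surj V p :=
  ⟨⟨hgood, by rw [hap]; exact dvd_zero _⟩, fun h ↦ hns (serre_hasSurjectiveModNGaloisRep_pow_holds V p hp5 h)⟩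

/-- **`K_V` is unramified at `p` and outside the additive primes** (Serre §4.2 c) / Prop. 14 at `p`, (ii) away from
`p`). On a row of crux 19606, for every place `v` of `ℚ` which IS `p`, or at which `V` has good reduction, or
multiplicative reduction, and every prime `𝔔` of `ℤ̄` above `v`: every `σ` in the inertia group `I_𝔔` centralises the
squares on `V[p]`, i.e. `I_𝔔 ≤ H_V = ρ̄⁻¹(C_ns(p))`. At `p`: the inertia image IS the Cartan subgroup (Prop. 12 c) +
Prop. 14); at good `v ≠ p`: `V[p]` is unramified; at multiplicative `v`: the Tate-curve inertia is unipotent of order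
dividing `p ∤ #Im ρ̄`, hence trivial (cf. `…PlusEtaNonsurjSteinbergHandleIdle`: `p ∣ v_ℓ(Δ_min)`). So the Cartan field
`K_V` ramifies only at ADDITIVE primes of `V`. [cite: Serre1972, §1.11 Prop. 12 c), §2.2 Prop. 14, §4.2 c), §5.4]
[cite: Zywina2015, Thm. 1.4] -/
theorem inertia_centralizes_sq_of_row (hp5 : 5 ≤ p) (hgood : V.HasGoodReductionAtPrime p)
    (hap : V.frobeniusTrace p = 0) (hns : ¬ ∀ m : ℕ, V.HasSurjectiveModNGaloisRep (p ^ m : ℕ))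
    {v : HeightOneSpectrum (𝓞 ℚ)}
    (hv : (p : 𝓞 ℚ) ∈ v.asIdeal ∨ V.HasGoodReductionAt v ∨ V.HasMultiplicativeReductionAt v)
    {𝔔 : Ideal (absIntegers (𝓞 ℚ) ℚ)} (h𝔔 : 𝔔 ∈ v.primesAbove) {σ : absoluteGaloisGroup ℚ}
    (hσ : σ ∈ 𝔔.inertia (absoluteGaloisGroup ℚ)) :
    ∀ (τ : absoluteGaloisGroup ℚ) (P : geomTorsion V p), σ • ((τ * τ) • P) = (τ * τ) • (σ • P) := by
  have hp2 : p ≠ 2 := by omega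
  obtain ⟨hss, hns'⟩ := goodSS_and_not_surj_of_row V p hp5 hgood hap hns
  obtain ⟨e, Φ, he, -⟩ := exists_frame_galoisRepTorsion_rat V p
  obtain ⟨k, hk, h2, hGN, -, -, -, hI⟩ := exists_index_two_subgroup_of_goodSS_of_not_surj V p Φ e he hp2 hss hns'
  have hσU := hI v hv 𝔔 h𝔔 hσ
  rw [mem_comap_cartan_iff] at hσU
  exact centralizes_sq_of_apply_mem_unitGroup V p Φ e he hp2 hk h2 hGN hσU

/-! ## §3 `p` is inert in `K_V` -/

/-- **`p` is INERT in the Cartan field** (Serre Prop. 12 d) on a row). On a row of crux 19606, above the place of `ℚ`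
at `p` there are a prime `𝔓` of `ℤ̄` and an element `φ` of its decomposition group `Stab(𝔓)` which does NOT centralise
the squares on `V[p]` (`φ ∉ H_V`; `φ` = an arithmetic Frobenius: it conjugates the tame inertia character of level `2`
into its `p`-th power, `galoisRepTorsion_not_mem_map_inertia_of_isArithFrobAt`, so `ρ̄(φ) ∉ ρ̄(I_𝔓) = kˣ`, and
`kˣ`-membership is `H_V`-membership by §1). With `inertia_centralizes_sq_of_row` (`I_𝔓 ≤ H_V`): `K_V/ℚ` is unramified
at `p` with residue degree `2`. [cite: Serre1972, §1.11 Prop. 12 c), d) (p. 275), §2.2 Prop. 14] -/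
theorem exists_frob_not_centralizes_sq_of_row (hp5 : 5 ≤ p) (hgood : V.HasGoodReductionAtPrime p)
    (hap : V.frobeniusTrace p = 0) (hns : ¬ ∀ m : ℕ, V.HasSurjectiveModNGaloisRep (p ^ m : ℕ))
    {v : HeightOneSpectrum (𝓞 ℚ)} (hv : (primesEquiv v : ℕ) = p) :
    ∃ 𝔓 ∈ v.primesAbove, ∃ φ ∈ MulAction.stabilizer (absoluteGaloisGroup ℚ) 𝔓,
      ¬ ∀ (τ : absoluteGaloisGroup ℚ) (P : geomTorsion V p), φ • ((τ * τ) • P) = (τ * τ) • (φ • P) := by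
  have hpp : p.Prime := hp.out
  have hp2 : p ≠ 2 := by omega
  have hp3 : 3 ≤ p := by omega
  obtain ⟨hss, hns'⟩ := goodSS_and_not_surj_of_row V p hp5 hgood hap hns
  have hΔ : ¬ (p : ℤ) ∣ minimalDiscriminantInt V := V.not_dvd_minimalDiscriminantInt_of_hasGoodReductionAtPrime' p hgood
  obtain ⟨𝔓, h𝔓, φ, hφ, hnot, -, -⟩ :=
    exists_mem_stabilizer_galoisRepTorsion_not_mem_map_inertia p hΔ hss.2 hp2 hv
  refine ⟨𝔓, h𝔓, φ, hφ, fun hcen ↦ hnot ?_⟩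
  -- frame, the normalised Cartan subgroup `kˣ`, and the inertia Cartan subgroup `k'ˣ = kˣ`
  obtain ⟨e, Φ, he, -⟩ := exists_frame_galoisRepTorsion_rat V p
  obtain ⟨k, hk, h2, hkG, hGN, hGC⟩ := exists_le_normalizer_unitGroup_of_goodSS_of_not_surj V p Φ e he hp2 hss hns'
  have hφk : Φ (galoisRepTorsion V p φ) ∈ unitGroup k :=
    (apply_mem_unitGroup_iff_centralizes_sq V p Φ e he hp2 hss hns' hk h2 hGN hGC φ).mpr hcen
  obtain ⟨k', hk', h2', hk'I⟩ := exists_unitGroup_eq_inertia_image_of_goodSS V p Φ hp2 hss hv h𝔓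
  have hC : unitGroup k ∈ cartanSubgroups (ZMod p) := unitGroup_mem_cartanSubgroups hk h2
  have hIle : ((𝔓.inertia (absoluteGaloisGroup ℚ)).map (galoisRepTorsion V p)).map Φ.toMonoidHom ≤
      (galoisRepTorsion V p).range.map Φ.toMonoidHom :=
    Subgroup.map_mono (fun x ⟨τ, _, hτ⟩ ↦ ⟨τ, hτ⟩)
  have hk'N : unitGroup k' ≤ Subgroup.normalizer (unitGroup k : Set (GL (Fin 2) (ZMod p))) := by
    rw [← hk'I]
    exact hIle.trans hGN
  have hkk : unitGroup k' = unitGroup k := prop14_unitGroup hC hp3 hk' h2' hk'N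
  rw [← hkk, ← hk'I] at hφk
  obtain ⟨x, hx, hxφ⟩ := hφk
  have hxeq : x = galoisRepTorsion V p φ := Φ.injective hxφ
  rw [← hxeq]
  exact hx

set_option synthInstance.maxHeartbeats 100000 in
/-- **`p` is inert in `K_V` — above EVERY prime `𝔓 ∣ p` of `ℤ̄`** there is `φ ∈ Stab(𝔓)` outside `H_V` (the primes
above `p` are conjugate, `Stab(g • 𝔓) = g Stab(𝔓) g⁻¹`, and `H_V` has index `2`, hence is normal).
[cite: Serre1972, §1.11 Prop. 12 d)] [cite: NeukirchANT1999, Ch. I §9 (9.4)–(9.6)] -/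
theorem forall_exists_frob_not_centralizes_sq_of_row (hp5 : 5 ≤ p) (hgood : V.HasGoodReductionAtPrime p)
    (hap : V.frobeniusTrace p = 0) (hns : ¬ ∀ m : ℕ, V.HasSurjectiveModNGaloisRep (p ^ m : ℕ))
    {v : HeightOneSpectrum (𝓞 ℚ)} (hv : (primesEquiv v : ℕ) = p)
    {𝔓 : Ideal (absIntegers (𝓞 ℚ) ℚ)} (h𝔓 : 𝔓 ∈ v.primesAbove) :
    ∃ φ ∈ MulAction.stabilizer (absoluteGaloisGroup ℚ) 𝔓,
      ¬ ∀ (τ : absoluteGaloisGroup ℚ) (P : geomTorsion V p), φ • ((τ * τ) • P) = (τ * τ) • (φ • P) := by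
  have hp2 : p ≠ 2 := by omega
  obtain ⟨𝔓₀, h𝔓₀, φ₀, hφ₀, hnot⟩ := exists_frob_not_centralizes_sq_of_row V p hp5 hgood hap hns hv
  obtain ⟨g, hg⟩ := HeightOneSpectrum.exists_smul_eq_of_mem_primesAbove_holds (K := ℚ) (v := v) h𝔓₀ h𝔓
  obtain ⟨H, hH2, hHmem⟩ := exists_cartanSubgroup_of_row V p hp5 hgood hap hns
  haveI : H.Normal := Subgroup.normal_of_index_eq_two hH2
  refine ⟨g * φ₀ * g⁻¹, ?_, ?_⟩
  · rw [MulAction.mem_stabilizer_iff, ← hg, mul_smul, mul_smul, inv_smul_smul, MulAction.mem_stabilizer_iff.mp hφ₀]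
  · rw [← hHmem]
    intro hmem
    have h0 : φ₀ ∈ H := by
      have := Subgroup.Normal.conj_mem inferInstance (g * φ₀ * g⁻¹) hmem g⁻¹
      rwa [inv_inv, ← mul_assoc, ← mul_assoc, inv_mul_cancel, one_mul, mul_assoc, inv_mul_cancel, mul_one] at this
    exact hnot ((hHmem φ₀).mp h0)

/-- **The local structure of the Cartan subgroup of a row of crux 19606, packaged.** For `V/ℚ` globally minimal,
`p ≥ 5` good with `a_p = 0` and `p`-adic tower not onto, there is an index-`2` subgroup `H_V ≤ Γ_ℚ` (membership =
"centralises the squares on `V[p]`", i.e. `H_V = ρ̄⁻¹(C_ns(p))`, fixed field the Cartan field `K_V`) such that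
(i) `H_V` contains the inertia group of every prime of `ℤ̄` above `p` and above every place of good or multiplicative
reduction — `K_V` is unramified at `p` and ramifies only at additive primes of `V` —, and (ii) above every prime
`𝔓 ∣ p` some element of the decomposition group lies outside `H_V` — `p` is INERT in `K_V`. (With
`…CartanFieldImaginary`: `K_V` is an imaginary quadratic field.) [cite: Serre1972, §1.11 Prop. 12 c), d), §2.2 Prop. 14,
§4.2 c)] [cite: Zywina2015, Thm. 1.4] -/
theorem cartanSubgroup_local_of_row (hp5 : 5 ≤ p) (hgood : V.HasGoodReductionAtPrime p)
    (hap : V.frobeniusTrace p = 0) (hns : ¬ ∀ m : ℕ, V.HasSurjectiveModNGaloisRep (p ^ m : ℕ)) :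
    ∃ H : Subgroup (absoluteGaloisGroup ℚ), H.index = 2 ∧
      (∀ σ : absoluteGaloisGroup ℚ, σ ∈ H ↔
        ∀ (τ : absoluteGaloisGroup ℚ) (P : geomTorsion V p), σ • ((τ * τ) • P) = (τ * τ) • (σ • P)) ∧
      (∀ v : HeightOneSpectrum (𝓞 ℚ),
        ((p : 𝓞 ℚ) ∈ v.asIdeal ∨ V.HasGoodReductionAt v ∨ V.HasMultiplicativeReductionAt v) →
        ∀ 𝔔 ∈ v.primesAbove, 𝔔.inertia (absoluteGaloisGroup ℚ) ≤ H) ∧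
      (∀ v : HeightOneSpectrum (𝓞 ℚ), (primesEquiv v : ℕ) = p →
        ∀ 𝔓 ∈ v.primesAbove, ∃ φ ∈ MulAction.stabilizer (absoluteGaloisGroup ℚ) 𝔓, φ ∉ H) := by
  obtain ⟨H, hH2, hHmem⟩ := exists_cartanSubgroup_of_row V p hp5 hgood hap hns
  refine ⟨H, hH2, hHmem, fun v hv 𝔔 h𝔔 σ hσ ↦ ?_, fun v hv 𝔓 h𝔓 ↦ ?_⟩
  · exact (hHmem σ).mpr (inertia_centralizes_sq_of_row V p hp5 hgood hap hns hv h𝔔 hσ)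
  · obtain ⟨φ, hφ, hnot⟩ := forall_exists_frob_not_centralizes_sq_of_row V p hp5 hgood hap hns hv h𝔓
    exact ⟨φ, hφ, fun h ↦ hnot ((hHmem φ).mp h)⟩

/-! ## §4 Consequence for CM anchors: `p` inert in the CM field, which is unramified outside `N_add(V)` -/

/-- **The CM field of a CM anchor is unramified at `p` and at the good and multiplicative places of the row.** If the
row `V` is mod-`p` congruent to a curve `A` with image `C_ns⁺(p)` carrying a `√D`-structure `(Ψ ≠ 0, χ ≠ 1)` (the
displayed CM input of `…CartanFieldCMAnchor`; `K = ℚ̄^{ker χ}` the CM field), then `χ` kills the inertia group of every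
prime of `ℤ̄` above `p`, above every good place and above every multiplicative place of `V` (`H_V = ker χ` by
`centralizes_sq_iff_chi_eq_one_of_modPCongruent`, and §2). [cite: Serre1972, §4.2 c), §4.5] [cite: Lang1987, Ch. 10 §4] -/
theorem chi_eq_one_of_mem_inertia_of_cmAnchor_of_row (hp5 : 5 ≤ p) (hgood : V.HasGoodReductionAtPrime p)
    (hap : V.frobeniusTrace p = 0) (hns : ¬ ∀ m : ℕ, V.HasSurjectiveModNGaloisRep (p ^ m : ℕ))
    {A : WeierstrassCurve ℚ} (hVA : ModPCongruent V A p) (hA : HasModPImageEqNonsplitCartanNormalizer A p)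
    (χ : absoluteGaloisGroup ℚ →* ℤˣ) (hχ : ∃ σ : absoluteGaloisGroup ℚ, χ σ ≠ 1)
    (Ψ : AddMonoid.End (A.geomTorsion p)) (hΨ0 : Ψ ≠ 0)
    (hΨ : ∀ (σ : absoluteGaloisGroup ℚ) (P : A.geomTorsion p), Ψ (σ • P) = ((χ σ : ℤˣ) : ℤ) • σ • Ψ P)
    {v : HeightOneSpectrum (𝓞 ℚ)}
    (hv : (p : 𝓞 ℚ) ∈ v.asIdeal ∨ V.HasGoodReductionAt v ∨ V.HasMultiplicativeReductionAt v)
    {𝔔 : Ideal (absIntegers (𝓞 ℚ) ℚ)} (h𝔔 : 𝔔 ∈ v.primesAbove) {σ : absoluteGaloisGroup ℚ}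
    (hσ : σ ∈ 𝔔.inertia (absoluteGaloisGroup ℚ)) : χ σ = 1 :=
  (centralizes_sq_iff_chi_eq_one_of_modPCongruent (by omega) hVA hA χ hχ Ψ hΨ0 hΨ σ).mp
    (inertia_centralizes_sq_of_row V p hp5 hgood hap hns hv h𝔔 hσ)

/-- **`p` is inert in the CM field of every CM anchor of a row.** In the situation of
`chi_eq_one_of_mem_inertia_of_cmAnchor_of_row`, above every prime `𝔓 ∣ p` of `ℤ̄` some element `φ` of the decomposition
group has `χ(φ) ≠ 1` — together with `χ(I_𝔓) = 1`: the prime `p` is INERT in `K = ℚ̄^{ker χ}`. At `p = 5` (with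
`…CartanFieldImaginary`: `K` imaginary; class number one for a CM curve over `ℚ`) this leaves
`K ∈ {ℚ(√−2), ℚ(√−3), ℚ(√−7), ℚ(√−43), ℚ(√−67), ℚ(√−163)}` — g5's census list, now by structure.
[cite: Serre1972, §1.11 Prop. 12 d), §4.5] [cite: Lang1987, Ch. 10 §4] -/
theorem exists_frob_chi_ne_one_of_cmAnchor_of_row (hp5 : 5 ≤ p) (hgood : V.HasGoodReductionAtPrime p)
    (hap : V.frobeniusTrace p = 0) (hns : ¬ ∀ m : ℕ, V.HasSurjectiveModNGaloisRep (p ^ m : ℕ))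
    {A : WeierstrassCurve ℚ} (hVA : ModPCongruent V A p) (hA : HasModPImageEqNonsplitCartanNormalizer A p)
    (χ : absoluteGaloisGroup ℚ →* ℤˣ) (hχ : ∃ σ : absoluteGaloisGroup ℚ, χ σ ≠ 1)
    (Ψ : AddMonoid.End (A.geomTorsion p)) (hΨ0 : Ψ ≠ 0)
    (hΨ : ∀ (σ : absoluteGaloisGroup ℚ) (P : A.geomTorsion p), Ψ (σ • P) = ((χ σ : ℤˣ) : ℤ) • σ • Ψ P)
    {v : HeightOneSpectrum (𝓞 ℚ)} (hv : (primesEquiv v : ℕ) = p)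
    {𝔓 : Ideal (absIntegers (𝓞 ℚ) ℚ)} (h𝔓 : 𝔓 ∈ v.primesAbove) :
    ∃ φ ∈ MulAction.stabilizer (absoluteGaloisGroup ℚ) 𝔓, χ φ ≠ 1 := by
  obtain ⟨φ, hφ, hnot⟩ := forall_exists_frob_not_centralizes_sq_of_row V p hp5 hgood hap hns hv h𝔓
  exact ⟨φ, hφ, fun h ↦
    hnot ((centralizes_sq_iff_chi_eq_one_of_modPCongruent (by omega) hVA hA χ hχ Ψ hΨ0 hΨ φ).mpr h)⟩

end Row

end Summit.BirchSwinnertonDyer.BirchSwinnertonDyer.Theorems.EtaCartanField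

end
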